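import Mathlib
import HarnessLib
import Literature.Analysis.FluidPDE.TsaiMaximumPrinciple

/-!
# Route `HalfSpaceWindowDoor`, crux `CirculationCarryingRigidity` (stmt-NavierStokesRegularity-25311) — line
# `rot_bernoulli`, II: Tsai's Liouville-type Lemma 5.1 for drifts with a SKEW LINEAR (rotational) component

LEAD ns-hsw-p1 g11 (cell pub-ns-dss).  Tool file of the census line `rot_bernoulli` (see `…RotHead`): the maximum
principle / Liouville-type lemma of Tsai 1998 (Lemma 5.1, in the corrected form of the tree's `TsaiMaximumPrinciple`:
`ν ΔΘ − DΘ[U + a y] ≥ 0`, `|U| ≤ M + b|y|` with `b < a`, `|Θ| ≤ C e^{κ|y|²}`, `κ < (a − b)/(2ν)` ⇒ `Θ` constant) for the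
drift `U + T + a y` of the rotation-corrected Bernoulli function, where `T : E →L[ℝ] E` is SKEW (`⟪v, T v⟫ = 0`; in the
application `T = −α e₃×`, of operator norm `|α|` — NOT small against `a = ½`).  The point: the tree lemma measures the
drift by its NORM, but its Gaussian barriers `e^{∓k|y − x₀|²}` only feel the RADIAL component
`⟪y − x₀, U y + T y + a y⟫ = ⟪y − x₀, U y + a y⟫ + ⟪y − x₀, T x₀⟫` (skewness), and `|⟪y − x₀, T x₀⟫| ≤ ‖T x₀‖ |y − x₀|` is
absorbed into the constant `M ↦ M + ‖T x₀‖` of the affine bound at the centre `x₀`.  The proofs below are the tree's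
proofs VERBATIM with this one substitution (`drift_inner_lower_skew`, `abs_drift_inner_le_skew`, the three barrier
estimates, `isConst_of_driftOp_nonneg_skew`, `…_of_eventually_skew`, `…_of_poly_skew`); every other ingredient
(`driftOp_gaussAt`, `driftOp_add_smul_sub`, `le_far_of_gauss_penalisation`, the quadratic arithmetic) is used by name.

WHAT THIS IS NOT: not a statement about Navier–Stokes regularity (Clay A); helper `--supports` 25311 (line `rot_bernoulli`,
consumed by `…RotHeadLiouville`); the item stays OPEN at its research stub; the mathematics is Tsai 1998 Lemma 5.1 /
Lemarié-Rieusset 2016 Lemma 16.8.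
-/

noncomputable section

-- the summit and its single sub-problem share the name (CONVENTIONS §1), as in every Theorems file
set_option linter.dupNamespace false

namespace Summit.NavierStokesRegularity.NavierStokesRegularity.Theorems.HalfSpaceWindowDoorCirculationCarryingRigiditySkewDrift

open MeasureTheory Set Filter Topology InnerProductSpace Function Metric
open scoped RealInnerProductSpace Laplacian ContDiff
open Literature.Analysis Literature.Analysis.FluidPDE

variable {E : Type*} [NormedAddCommGroup E] [InnerProductSpace ℝ E]

/-! ### Radial components of a drift with a skew part -/

/-- For a skew `T`, `⟪y − x₀, T y⟫ = ⟪y − x₀, T x₀⟫`. -/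
theorem inner_sub_skew_apply {T : E →L[ℝ] E} (hT : ∀ v, ⟪v, T v⟫ = 0) (x₀ y : E) :
    ⟪y - x₀, T y⟫ = ⟪y - x₀, T x₀⟫ := by
  have h : T y = T (y - x₀) + T x₀ := by rw [← map_add, sub_add_cancel]
  rw [h, inner_add_right, hT, zero_add]

/-- Radial lower bound (skew variant of the tree's `drift_inner_lower`): if `|U(y)| ≤ M + b|y|` and `T` is skew then
`⟨y − x₀, U(y) + T y + a y⟩ ≥ (a − b)|y − x₀|² − ((M + ‖T x₀‖) + (a + b)|x₀|)|y − x₀|`. -/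
theorem drift_inner_lower_skew {a b M : ℝ} (hb : 0 ≤ b) (ha : 0 ≤ a) {U : E → E}
    (hU : ∀ y, ‖U y‖ ≤ M + b * ‖y‖) {T : E →L[ℝ] E} (hT : ∀ v, ⟪v, T v⟫ = 0) (x₀ y : E) :
    (a - b) * ‖y - x₀‖ ^ 2 - ((M + ‖T x₀‖) + (a + b) * ‖x₀‖) * ‖y - x₀‖ ≤
      ⟪y - x₀, (U y + T y) + a • y⟫ := by
  have h0 := drift_inner_lower hb ha hU x₀ y
  have hsplit : (U y + T y) + a • y = (U y + a • y) + T y := by abel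
  have hbd : |⟪y - x₀, T x₀⟫| ≤ ‖y - x₀‖ * ‖T x₀‖ := abs_real_inner_le_norm _ _
  rw [hsplit, inner_add_right, inner_sub_skew_apply hT x₀ y]
  nlinarith [neg_abs_le ⟪y - x₀, T x₀⟫, hbd, norm_nonneg (y - x₀)]

/-- Radial upper bound (skew variant of the tree's `abs_drift_inner_le`):
`|⟨y − x₀, U(y) + T y + a y⟩| ≤ (((M + ‖T x₀‖) + (a + b)|x₀|) + (a + b)|y − x₀|)|y − x₀|`. -/
theorem abs_drift_inner_le_skew {a b M : ℝ} (hb : 0 ≤ b) (ha : 0 ≤ a) {U : E → E}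
    (hU : ∀ y, ‖U y‖ ≤ M + b * ‖y‖) {T : E →L[ℝ] E} (hT : ∀ v, ⟪v, T v⟫ = 0) (x₀ y : E) :
    |⟪y - x₀, (U y + T y) + a • y⟫| ≤
      (((M + ‖T x₀‖) + (a + b) * ‖x₀‖) + (a + b) * ‖y - x₀‖) * ‖y - x₀‖ := by
  have h0 := abs_drift_inner_le hb ha hU x₀ y
  have hsplit : (U y + T y) + a • y = (U y + a • y) + T y := by abel
  have hbd : |⟪y - x₀, T x₀⟫| ≤ ‖y - x₀‖ * ‖T x₀‖ := abs_real_inner_le_norm _ _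
  rw [hsplit, inner_add_right, inner_sub_skew_apply hT x₀ y]
  refine (abs_add_le _ _).trans ?_
  nlinarith [hbd, norm_nonneg (y - x₀), norm_nonneg (T x₀)]

variable [FiniteDimensional ℝ E]

/-! ### The three barrier estimates with a skew drift component -/

/-- Skew-drift variant of the tree's `driftOp_gaussAt_neg_lower` (barrier `φ = e^{−β|y−x₀|²}`): the tangential part `T`
of the drift costs only the constant `‖T x₀‖` (Lemarié-Rieusset, proof of Lemma 16.8). -/
theorem driftOp_gaussAt_neg_lower_skew {ν a b M β : ℝ} (hb : 0 ≤ b) (hba : b ≤ a)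
    (hβ : 0 ≤ β) {U : E → E} (hU : ∀ y, ‖U y‖ ≤ M + b * ‖y‖) {T : E →L[ℝ] E}
    (hT : ∀ v, ⟪v, T v⟫ = 0) (x₀ y : E) :
    β * gaussAt (-β) x₀ y *
        (4 * ν * β * ‖y - x₀‖ ^ 2 - 2 * ((M + ‖T x₀‖) + (a + b) * ‖x₀‖) * ‖y - x₀‖ -
          2 * (Module.finrank ℝ E) * ν) ≤ driftOp ν a (fun z => U z + T z) (gaussAt (-β) x₀) y := by
  rw [driftOp_gaussAt]
  have ha : 0 ≤ a := hb.trans hba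
  have hlow := drift_inner_lower_skew hb ha hU hT x₀ y
  have hpos := (gaussAt_pos (-β) x₀ y).le
  have hab : 0 ≤ (a - b) * ‖y - x₀‖ ^ 2 := mul_nonneg (sub_nonneg.2 hba) (sq_nonneg _)
  have key : β * (4 * ν * β * ‖y - x₀‖ ^ 2 - 2 * ((M + ‖T x₀‖) + (a + b) * ‖x₀‖) * ‖y - x₀‖ -
      2 * (Module.finrank ℝ E) * ν) ≤
      ν * (4 * (-β) ^ 2 * ‖y - x₀‖ ^ 2 + 2 * (Module.finrank ℝ E) * (-β)) -
        2 * (-β) * ⟪y - x₀, (U y + T y) + a • y⟫ := by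
    have h' : -(((M + ‖T x₀‖) + (a + b) * ‖x₀‖) * ‖y - x₀‖) ≤ ⟪y - x₀, (U y + T y) + a • y⟫ := by
      linarith
    nlinarith [mul_le_mul_of_nonneg_left h' hβ]
  calc _ = gaussAt (-β) x₀ y * (β * (4 * ν * β * ‖y - x₀‖ ^ 2 -
      2 * ((M + ‖T x₀‖) + (a + b) * ‖x₀‖) * ‖y - x₀‖ - 2 * (Module.finrank ℝ E) * ν)) := by ring
    _ ≤ _ := mul_le_mul_of_nonneg_left key hpos

/-- Skew-drift variant of the tree's `driftOp_gaussAt_upper` (penalisation `ψ = e^{k|y−x₀|²}`, negative far out when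
`k < (a − b)/(2ν)`; Tsai 1998, (1.11)–(1.12)). -/
theorem driftOp_gaussAt_upper_skew {ν a b M k : ℝ} (hb : 0 ≤ b) (hba : b ≤ a)
    (hk : 0 ≤ k) {U : E → E} (hU : ∀ y, ‖U y‖ ≤ M + b * ‖y‖) {T : E →L[ℝ] E}
    (hT : ∀ v, ⟪v, T v⟫ = 0) (x₀ y : E) :
    driftOp ν a (fun z => U z + T z) (gaussAt k x₀) y ≤ k * gaussAt k x₀ y *
      (2 * (Module.finrank ℝ E) * ν + 2 * ((M + ‖T x₀‖) + (a + b) * ‖x₀‖) * ‖y - x₀‖ -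
        (2 * (a - b) - 4 * ν * k) * ‖y - x₀‖ ^ 2) := by
  rw [driftOp_gaussAt]
  have ha : 0 ≤ a := hb.trans hba
  have hlow := drift_inner_lower_skew hb ha hU hT x₀ y
  have hpos := (gaussAt_pos k x₀ y).le
  have key : ν * (4 * k ^ 2 * ‖y - x₀‖ ^ 2 + 2 * (Module.finrank ℝ E) * k) -
      2 * k * ⟪y - x₀, (U y + T y) + a • y⟫ ≤ k * (2 * (Module.finrank ℝ E) * ν +
        2 * ((M + ‖T x₀‖) + (a + b) * ‖x₀‖) * ‖y - x₀‖ - (2 * (a - b) - 4 * ν * k) * ‖y - x₀‖ ^ 2) := by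
    nlinarith [mul_le_mul_of_nonneg_left hlow hk]
  calc _ ≤ gaussAt k x₀ y * (k * (2 * (Module.finrank ℝ E) * ν +
        2 * ((M + ‖T x₀‖) + (a + b) * ‖x₀‖) * ‖y - x₀‖ - (2 * (a - b) - 4 * ν * k) * ‖y - x₀‖ ^ 2)) :=
        mul_le_mul_of_nonneg_left key hpos
    _ = _ := by ring

/-- Skew-drift variant of the tree's `abs_driftOp_gaussAt_le` (crude two-sided bound for the penalisation). -/
theorem abs_driftOp_gaussAt_le_skew {ν a b M k : ℝ} (hν : 0 ≤ ν) (hb : 0 ≤ b) (hba : b ≤ a)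
    (hk : 0 ≤ k) {U : E → E} (hU : ∀ y, ‖U y‖ ≤ M + b * ‖y‖) {T : E →L[ℝ] E}
    (hT : ∀ v, ⟪v, T v⟫ = 0) (x₀ y : E) :
    |driftOp ν a (fun z => U z + T z) (gaussAt k x₀) y| ≤ k * gaussAt k x₀ y *
      (4 * ν * k * ‖y - x₀‖ ^ 2 + 2 * (Module.finrank ℝ E) * ν +
        2 * (((M + ‖T x₀‖) + (a + b) * ‖x₀‖) + (a + b) * ‖y - x₀‖) * ‖y - x₀‖) := by
  rw [driftOp_gaussAt, abs_mul, abs_of_pos (gaussAt_pos _ _ _)]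
  have ha : 0 ≤ a := hb.trans hba
  have habs := abs_drift_inner_le_skew hb ha hU hT x₀ y
  have hpos := (gaussAt_pos k x₀ y).le
  have hd : (0 : ℝ) ≤ Module.finrank ℝ E := Nat.cast_nonneg _
  have key : |ν * (4 * k ^ 2 * ‖y - x₀‖ ^ 2 + 2 * (Module.finrank ℝ E) * k) -
      2 * k * ⟪y - x₀, (U y + T y) + a • y⟫| ≤ k * (4 * ν * k * ‖y - x₀‖ ^ 2 +
        2 * (Module.finrank ℝ E) * ν + 2 * (((M + ‖T x₀‖) + (a + b) * ‖x₀‖) + (a + b) * ‖y - x₀‖) *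
          ‖y - x₀‖) := by
    refine (abs_sub _ _).trans ?_
    rw [abs_of_nonneg (by positivity : 0 ≤ ν * (4 * k ^ 2 * ‖y - x₀‖ ^ 2 +
      2 * (Module.finrank ℝ E) * k)), abs_mul, abs_of_nonneg (by positivity : 0 ≤ 2 * k)]
    nlinarith [mul_le_mul_of_nonneg_left habs (by positivity : 0 ≤ 2 * k)]
  calc _ ≤ gaussAt k x₀ y * (k * (4 * ν * k * ‖y - x₀‖ ^ 2 +
        2 * (Module.finrank ℝ E) * ν + 2 * (((M + ‖T x₀‖) + (a + b) * ‖x₀‖) + (a + b) * ‖y - x₀‖) *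
          ‖y - x₀‖)) := mul_le_mul_of_nonneg_left key hpos
    _ = _ := by ring

/-! ### The Liouville-type lemma with a skew drift component -/

/-- **Tsai's Liouville-type lemma with a SKEW (tangential) drift component** — the tree's
`isConst_of_driftOp_nonneg` (Tsai 1998, Lemma 5.1; Lemarié-Rieusset, Lemma 16.8) for the drift `U + T + a y`, `T` a skew
continuous linear map (`⟪v, T v⟫ = 0`), whose norm may grow linearly at ANY rate: only radial components enter the
barrier argument, and `⟪y − x₀, T y⟫ = ⟪y − x₀, T x₀⟫` is affine in `|y − x₀|`.  ORIGINAL DOCSTRING: Let `E` be a finite-dimensional real inner product space, `ν > 0`, `0 ≤ b < a`,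
`κ < (a − b)/(2ν)`. Let `Θ ∈ C²(E)` and `U : E → E` satisfy `|U(y)| ≤ M + b|y|` for all `y`,
`ν ΔΘ − DΘ[U + a y] ≥ 0` on `E` (that is, `−νΔΘ + (U + a y)·∇Θ ≤ 0`, Tsai's (5.1)) and
`|Θ(y)| ≤ C e^{κ|y|²}`. Then `Θ` is constant. See the module docstring for why the growth bound
`o(∫₂^{|y|} e^{cs²/2} ds)`, `c = (a − b)/ν`, printed in Tsai's Lemma 5.1 has to be replaced (the
Gaussian exponent `κ < c/2` is sharp). [cite: LemarieRieusset2016, Lemma 16.8] -/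
theorem isConst_of_driftOp_nonneg_skew {ν a b M κ C : ℝ} (hν : 0 < ν) (hb : 0 ≤ b) (hba : b < a)
    (hκ : κ < (a - b) / (2 * ν)) {Θ : E → ℝ} {U : E → E} {T : E →L[ℝ] E} (hΘ : ContDiff ℝ 2 Θ)
    (hsub : ∀ y, 0 ≤ driftOp ν a (fun z => U z + T z) Θ y) (hU : ∀ y, ‖U y‖ ≤ M + b * ‖y‖)
    (hT : ∀ v, ⟪v, T v⟫ = 0)
    (hgrowth : ∀ y, |Θ y| ≤ C * Real.exp (κ * ‖y‖ ^ 2)) (x y : E) : Θ x = Θ y := by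
  -- reduce to: no pair `X₀, X₁` with `Θ X₀ < Θ X₁`
  suffices key : ∀ X₀ X₁ : E, ¬ (Θ X₀ < Θ X₁) by
    rcases lt_trichotomy (Θ x) (Θ y) with h | h | h
    · exact absurd h (key x y)
    · exact h
    · exact absurd h (key y x)
  intro X₀ X₁ hlt
  -- basic constants
  have ha : 0 < a := hb.trans_lt hba
  have hab : 0 < a - b := sub_pos.2 hba
  have hM : 0 ≤ M := by
    have := hU 0
    rw [norm_zero, mul_zero, add_zero] at this
    exact (norm_nonneg _).trans this
  have hC : 0 ≤ C := by
    have := hgrowth 0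
    rw [norm_zero] at this
    norm_num at this
    exact (abs_nonneg _).trans this
  have hd0 : (0 : ℝ) ≤ (Module.finrank ℝ E : ℝ) := Nat.cast_nonneg _
  obtain ⟨δ, hδ0, hδ⟩ : ∃ δ : ℝ, 0 < δ ∧ Θ X₁ = Θ X₀ + δ := ⟨Θ X₁ - Θ X₀, sub_pos.2 hlt, by ring⟩
  have hX : X₁ ≠ X₀ := fun h => by rw [h] at hlt; exact lt_irrefl _ hlt
  have hs₁0 : 0 < ‖X₁ - X₀‖ := norm_pos_iff.2 (sub_ne_zero.2 hX)
  obtain ⟨M₁, hM₁0, hM₁⟩ : ∃ M₁ : ℝ, 0 ≤ M₁ ∧ M₁ = (M + ‖T X₀‖) + (a + b) * ‖X₀‖ :=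
    ⟨_, by positivity, rfl⟩
  have hΘc : Continuous Θ := hΘ.continuous
  -- `R₀`: a small ball about `X₀` on which `Θ ≤ Θ X₀ + δ/2`
  obtain ⟨R₀, hR₀0, hR₀s, hR₀Θ⟩ : ∃ R₀ : ℝ, 0 < R₀ ∧ R₀ < ‖X₁ - X₀‖ ∧
      ∀ y, ‖y - X₀‖ ≤ R₀ → Θ y ≤ Θ X₀ + δ / 2 := by
    obtain ⟨η, hη0, hη⟩ := Metric.continuousAt_iff.1 hΘc.continuousAt (δ / 2) (half_pos hδ0)
    refine ⟨min (η / 2) (‖X₁ - X₀‖ / 2), lt_min (half_pos hη0) (half_pos hs₁0),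
      (min_le_right _ _).trans_lt (half_lt_self hs₁0), fun y hy => ?_⟩
    have hdist : dist y X₀ < η := by
      rw [dist_eq_norm]; exact (hy.trans (min_le_left _ _)).trans_lt (half_lt_self hη0)
    have := hη hdist
    rw [Real.dist_eq] at this
    linarith [(abs_lt.1 this).2]
  -- `β` and the barrier `φ = exp(-β |y - X₀|²)`
  obtain ⟨β, hβ0, hβeq⟩ : ∃ β : ℝ, 0 < β ∧
      4 * ν * β * R₀ ^ 2 = 2 * M₁ * R₀ + 2 * (Module.finrank ℝ E : ℝ) * ν + 1 := by
    refine ⟨(2 * M₁ * R₀ + 2 * (Module.finrank ℝ E : ℝ) * ν + 1) / (4 * ν * R₀ ^ 2),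
      by positivity, ?_⟩
    field_simp
  obtain ⟨φ, hφ⟩ : ∃ φ : E → ℝ, φ = gaussAt (-β) X₀ := ⟨_, rfl⟩
  have hφ2 : ContDiff ℝ 2 φ := hφ ▸ contDiff_gaussAt _ _
  have hφle1 : ∀ y, φ y ≤ 1 := fun y => hφ ▸ gaussAt_le_one_of_nonpos (by linarith) _ _
  have hφpos : ∀ y, 0 < φ y := fun y => hφ ▸ gaussAt_pos _ _ _
  have hφL : ∀ y, R₀ ≤ ‖y - X₀‖ → β * φ y ≤ driftOp ν a (fun z => U z + T z) φ y := by
    intro y hy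
    have h1 := driftOp_gaussAt_neg_lower_skew (ν := ν) hb hba.le hβ0.le hU hT X₀ y
    have hq := one_le_barrier_quad hν.le hM₁0 hd0 hR₀0 hβeq hy
    rw [← hM₁] at h1
    rw [hφ]
    refine le_trans ?_ h1
    have h0 : 0 ≤ β * gaussAt (-β) X₀ y := mul_nonneg hβ0.le (gaussAt_pos _ _ _).le
    have := mul_le_mul_of_nonneg_left hq h0
    linarith
  -- `κ₁` and the penalisation `ψ = exp(κ₁ |y - X₀|²)`
  obtain ⟨κ₀, hκ₀0, hκκ₀, hκ₀lt⟩ : ∃ κ₀ : ℝ, 0 ≤ κ₀ ∧ κ ≤ κ₀ ∧ κ₀ < (a - b) / (2 * ν) :=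
    ⟨max κ 0, le_max_right _ _, le_max_left _ _, max_lt hκ (by positivity)⟩
  obtain ⟨κ₁, hκ₀₁, hκ₁lt⟩ : ∃ κ₁ : ℝ, κ₀ < κ₁ ∧ κ₁ < (a - b) / (2 * ν) :=
    ⟨(κ₀ + (a - b) / (2 * ν)) / 2, by linarith, by linarith⟩
  have hκ₁0 : 0 < κ₁ := hκ₀0.trans_lt hκ₀₁
  obtain ⟨B, hB0, hB⟩ : ∃ B : ℝ, 0 < B ∧ B = 2 * (a - b) - 4 * ν * κ₁ := by
    refine ⟨_, ?_, rfl⟩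
    have : 4 * ν * κ₁ < 4 * ν * ((a - b) / (2 * ν)) := by gcongr
    have e : 4 * ν * ((a - b) / (2 * ν)) = 2 * (a - b) := by field_simp; ring
    linarith
  obtain ⟨R₁, hR₁1, hR₁s, hR₁B⟩ : ∃ R₁ : ℝ, 1 ≤ R₁ ∧ ‖X₁ - X₀‖ + 1 ≤ R₁ ∧
      (2 * M₁ + 2 * (Module.finrank ℝ E : ℝ) * ν + 1) / B ≤ R₁ :=
    ⟨max (max 1 (‖X₁ - X₀‖ + 1)) ((2 * M₁ + 2 * (Module.finrank ℝ E : ℝ) * ν + 1) / B),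
      (le_max_left _ _).trans (le_max_left _ _), (le_max_right _ _).trans (le_max_left _ _),
      le_max_right _ _⟩
  have hR₀R₁ : R₀ < R₁ := by linarith
  have hs₁R₁ : ‖X₁ - X₀‖ ≤ R₁ := by linarith
  obtain ⟨ψ, hψ⟩ : ∃ ψ : E → ℝ, ψ = gaussAt κ₁ X₀ := ⟨_, rfl⟩
  have hψ2 : ContDiff ℝ 2 ψ := hψ ▸ contDiff_gaussAt _ _
  have hψpos : ∀ y, 0 < ψ y := fun y => hψ ▸ gaussAt_pos _ _ _
  have hψle : ∀ y, ‖y - X₀‖ ≤ R₁ → ψ y ≤ Real.exp (κ₁ * R₁ ^ 2) := fun y hy =>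
    hψ ▸ gaussAt_mono_radius hκ₁0.le _ hy
  have hψeq : ∀ y, ψ y = Real.exp (κ₁ * ‖y - X₀‖ ^ 2) := fun y => by rw [hψ]; rfl
  have hψL_far : ∀ y, R₁ ≤ ‖y - X₀‖ → driftOp ν a (fun z => U z + T z) ψ y ≤ -(κ₁ * ψ y) := by
    intro y hy
    have h1 := driftOp_gaussAt_upper_skew (ν := ν) hb hba.le hκ₁0.le hU hT X₀ y
    rw [← hM₁, ← hB] at h1
    have hBr : 2 * M₁ + 2 * (Module.finrank ℝ E : ℝ) * ν + 1 ≤ B * ‖y - X₀‖ := by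
      have := (div_le_iff₀ hB0).1 (hR₁B.trans hy)
      nlinarith
    have hq := one_le_penal_quad hν.le hd0 (hR₁1.trans hy) hBr
    rw [hψ]
    refine h1.trans ?_
    have h0 : 0 ≤ κ₁ * gaussAt κ₁ X₀ y := mul_nonneg hκ₁0.le (gaussAt_pos _ _ _).le
    have := mul_le_mul_of_nonneg_left hq h0
    linarith
  obtain ⟨K, hK0, hK⟩ : ∃ K : ℝ, 0 ≤ K ∧ K = κ₁ * Real.exp (κ₁ * R₁ ^ 2) *
      (4 * ν * κ₁ * R₁ ^ 2 + 2 * (Module.finrank ℝ E : ℝ) * ν +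
        2 * (M₁ + (a + b) * R₁) * R₁) := ⟨_, by positivity, rfl⟩
  have hψL_near : ∀ y, ‖y - X₀‖ ≤ R₁ → |driftOp ν a (fun z => U z + T z) ψ y| ≤ K := by
    intro y hy
    have h1 := abs_driftOp_gaussAt_le_skew hν.le hb hba.le hκ₁0.le hU hT X₀ y
    rw [← hM₁] at h1
    rw [hψ]
    refine h1.trans ?_
    rw [hK]
    have hr0 : 0 ≤ ‖y - X₀‖ := norm_nonneg _
    gcongr
    exact gaussAt_mono_radius hκ₁0.le _ hy
  -- the constants `γ`, `α` and the auxiliary function `V = Θ + α (φ - γ ψ)`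
  obtain ⟨Φm, hΦm0, hφL_mid⟩ : ∃ Φm : ℝ, 0 < Φm ∧
      ∀ y, R₀ ≤ ‖y - X₀‖ → ‖y - X₀‖ ≤ R₁ → Φm ≤ driftOp ν a (fun z => U z + T z) φ y := by
    refine ⟨β * Real.exp (-β * R₁ ^ 2), by positivity, fun y hy hy' => ?_⟩
    refine le_trans ?_ (hφL y hy)
    rw [hφ]
    exact mul_le_mul_of_nonneg_left (gaussAt_anti_radius (by linarith) X₀ hy') hβ0.le
  obtain ⟨γ, hγ0, hγK⟩ : ∃ γ : ℝ, 0 < γ ∧ γ * K < Φm := by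
    refine ⟨Φm / (2 * (K + 1)), by positivity, ?_⟩
    rw [div_mul_eq_mul_div, div_lt_iff₀ (by positivity)]
    nlinarith
  obtain ⟨S, hS0, hS⟩ : ∃ S : ℝ, 0 < S ∧ S = 1 + γ * Real.exp (κ₁ * R₁ ^ 2) :=
    ⟨_, by positivity, rfl⟩
  have hφψ : ∀ y, ‖y - X₀‖ ≤ R₁ → |φ y - γ * ψ y| ≤ S := by
    intro y hy
    refine (abs_sub _ _).trans ?_
    rw [abs_of_pos (hφpos y), abs_of_pos (mul_pos hγ0 (hψpos y)), hS]
    gcongr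
    · exact hφle1 y
    · exact hψle y hy
  obtain ⟨α, hα0, hαS⟩ : ∃ α : ℝ, 0 < α ∧ α * S = δ / 8 :=
    ⟨δ / (8 * S), by positivity, by field_simp⟩
  obtain ⟨V, hV⟩ : ∃ V : E → ℝ, V = Θ + α • (φ - γ • ψ) := ⟨_, rfl⟩
  have hVapply : ∀ y, V y = Θ y + α * (φ y - γ * ψ y) := fun y => by
    simp only [hV, Pi.add_apply, Pi.smul_apply, Pi.sub_apply, smul_eq_mul]
  have hV2 : ContDiff ℝ 2 V :=
    hV ▸ hΘ.add (contDiff_const.smul (hφ2.sub (contDiff_const.smul hψ2)))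
  have hLV : ∀ y, driftOp ν a (fun z => U z + T z) V y =
      driftOp ν a (fun z => U z + T z) Θ y + α * (driftOp ν a (fun z => U z + T z) φ y - γ * driftOp ν a (fun z => U z + T z) ψ y) := fun y =>
    hV ▸ driftOp_add_smul_sub ν a (fun z => U z + T z) hΘ hφ2 hψ2 α γ y
  -- `V X₁` is large, `V` is small on the small ball
  have hVX₁ : Θ X₀ + 7 * δ / 8 ≤ V X₁ := by
    rw [hVapply]
    have h1 := hφψ X₁ hs₁R₁
    have h2 : -S ≤ φ X₁ - γ * ψ X₁ := (neg_le_neg h1).trans (neg_abs_le _)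
    have h3 := mul_le_mul_of_nonneg_left h2 hα0.le
    rw [mul_neg, hαS] at h3
    linarith
  have hVsmall : ∀ y, ‖y - X₀‖ ≤ R₀ → V y < V X₁ := by
    intro y hy
    rw [hVapply]
    have h1 := hφψ y (hy.trans hR₀R₁.le)
    have h2 : φ y - γ * ψ y ≤ S := (le_abs_self _).trans h1
    have h3 := mul_le_mul_of_nonneg_left h2 hα0.le
    rw [hαS] at h3
    have h4 := hR₀Θ y hy
    linarith
  -- decay at infinity: `V ≤ V X₁` outside a large ball
  obtain ⟨R₂, hR₁R₂, hVfar⟩ : ∃ R₂ : ℝ, R₁ ≤ R₂ ∧ ∀ y, R₂ ≤ ‖y - X₀‖ → V y ≤ V X₁ :=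
    le_far_of_gauss_penalisation hC hgrowth hκκ₀ hκ₀0 hκ₀₁ hκ₁0 hψeq hφle1 hα0 hγ0
      hVapply X₁ R₁
  -- a global maximum `X₂` of `V`, where `L V ≤ 0`
  obtain ⟨X₂, hX₂⟩ : ∃ X₂, ∀ y, V y ≤ V X₂ :=
    exists_forall_le_of_le_outside hV2.continuous (hs₁R₁.trans hR₁R₂) hVfar
  have hLV2 : driftOp ν a (fun z => U z + T z) V X₂ ≤ 0 := driftOp_nonpos_of_isMax hν.le (fun z => U z + T z) hV2 hX₂
  rw [hLV] at hLV2
  have hΘ2 := hsub X₂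
  -- case analysis on the position of `X₂`
  rcases le_or_gt ‖X₂ - X₀‖ R₀ with h1 | h1
  · exact absurd (hX₂ X₁) (not_le.2 (hVsmall X₂ h1))
  have hpos : 0 < driftOp ν a (fun z => U z + T z) φ X₂ - γ * driftOp ν a (fun z => U z + T z) ψ X₂ := by
    rcases le_or_gt ‖X₂ - X₀‖ R₁ with h2 | h2
    · have hφ2' := hφL_mid X₂ h1.le h2
      have hψ2' := (le_abs_self _).trans (hψL_near X₂ h2)
      have := mul_le_mul_of_nonneg_left hψ2' hγ0.le
      linarith
    · have hφ2' := hφL X₂ (hR₀R₁.le.trans h2.le)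
      have hψ2' := hψL_far X₂ h2.le
      have e1 := mul_pos hβ0 (hφpos X₂)
      have e2 := mul_pos hγ0 (mul_pos hκ₁0 (hψpos X₂))
      have := mul_le_mul_of_nonneg_left hψ2' hγ0.le
      have e3 : γ * -(κ₁ * ψ X₂) = -(γ * (κ₁ * ψ X₂)) := by ring
      linarith
  have := mul_pos hα0 hpos
  linarith

/-- Skew-drift variant of the tree's `isConst_of_driftOp_nonneg_of_eventually`.  ORIGINAL DOCSTRING: **Tsai 1998, Lemma 5.1, in Tsai's form (corrected growth).** Let `E` be a finite-dimensional
real inner product space (Tsai: `ℝ³`; Remark 5.2: any `ℝⁿ`), `ν > 0`, and let `Θ ∈ C²(E)`,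
`U : E → E` continuous, satisfy `−νΔΘ + (U + a y)·∇Θ ≤ 0` on `E`. If `|U(y)| ≤ b|y|` for some
`b ∈ [0, a)` and all `|y| ≥ r₀`, and `|Θ(y)| ≤ C e^{κ|y|²}` with `κ < (a − b)/(2ν)` (replacing the
printed `o(∫₂^{|y|} e^{cs²/2} ds)`, `c = (a − b)/ν`, which is too weak — see the module
docstring), then `Θ` is constant. (`U` is bounded on the ball `|y| ≤ r₀`, whence an affine
bound `|U| ≤ M + b|y|`, and `isConst_of_driftOp_nonneg` applies.) [cite: Tsai1998, Lemma 5.1] -/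
theorem isConst_of_driftOp_nonneg_of_eventually_skew {ν a b κ C r₀ : ℝ} (hν : 0 < ν) (hb : 0 ≤ b)
    (hba : b < a) (hκ : κ < (a - b) / (2 * ν)) {Θ : E → ℝ} {U : E → E} {T : E →L[ℝ] E}
    (hΘ : ContDiff ℝ 2 Θ) (hUc : Continuous U) (hsub : ∀ y, 0 ≤ driftOp ν a (fun z => U z + T z) Θ y)
    (hU : ∀ y, r₀ ≤ ‖y‖ → ‖U y‖ ≤ b * ‖y‖) (hT : ∀ v, ⟪v, T v⟫ = 0)
    (hgrowth : ∀ y, |Θ y| ≤ C * Real.exp (κ * ‖y‖ ^ 2)) (x y : E) : Θ x = Θ y := by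
  -- `U` is bounded on the closed ball of radius `r₀`
  obtain ⟨M, hM⟩ : ∃ M, ∀ z ∈ closedBall (0 : E) r₀, ‖U z‖ ≤ M :=
    (isCompact_closedBall (0 : E) r₀).exists_bound_of_continuousOn hUc.continuousOn
  refine isConst_of_driftOp_nonneg_skew (M := max M 0) hν hb hba hκ hΘ hsub (fun z => ?_) hT hgrowth x y
  by_cases hz : r₀ ≤ ‖z‖
  · exact (hU z hz).trans (le_add_of_nonneg_left (le_max_right _ _))
  · have hz' : z ∈ closedBall (0 : E) r₀ := by
      rw [mem_closedBall, dist_zero_right]; exact (not_le.1 hz).le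
    exact (hM z hz').trans ((le_max_left _ _).trans (le_add_of_nonneg_right (by positivity)))

/-- Skew-drift variant of the tree's `isConst_of_driftOp_nonneg_of_poly`.  ORIGINAL DOCSTRING: **Tsai's Liouville-type lemma for polynomially bounded subsolutions** — the case used in the
proofs of Tsai's Theorems 1 and 2 ("the growth estimates `U(y) = o(|y|)`, `Π(y) = O(|y|^N)` …
Lemma 5.1 then implies that `Π` is constant", Tsai 1998, p. 48). Let `ν > 0`, `0 ≤ b < a`,
`Θ ∈ C²(E)`, `U` continuous with `|U(y)| ≤ b|y|` for `|y| ≥ r₀`, `−νΔΘ + (U + a y)·∇Θ ≤ 0` on `E`,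
and `|Θ(y)| ≤ C(1 + |y|)^N`. Then `Θ` is constant. [cite: Tsai1998, Lemma 5.1 and p. 48 (proofs of Theorems 1 and 2)] -/
theorem isConst_of_driftOp_nonneg_of_poly_skew {ν a b C r₀ : ℝ} {N : ℕ} (hν : 0 < ν) (hb : 0 ≤ b)
    (hba : b < a) {Θ : E → ℝ} {U : E → E} {T : E →L[ℝ] E} (hΘ : ContDiff ℝ 2 Θ) (hUc : Continuous U)
    (hsub : ∀ y, 0 ≤ driftOp ν a (fun z => U z + T z) Θ y) (hU : ∀ y, r₀ ≤ ‖y‖ → ‖U y‖ ≤ b * ‖y‖)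
    (hT : ∀ v, ⟪v, T v⟫ = 0)
    (hgrowth : ∀ y, |Θ y| ≤ C * (1 + ‖y‖) ^ N) (x y : E) : Θ x = Θ y := by
  have hC : 0 ≤ C := by
    have h := (abs_nonneg _).trans (hgrowth 0)
    rw [norm_zero, add_zero, one_pow, mul_one] at h
    exact h
  -- a Gaussian rate `κ = (a - b)/(4ν) < (a - b)/(2ν)`
  set κ := (a - b) / (4 * ν) with hκ
  have hab : 0 < a - b := sub_pos.2 hba
  have hκ0 : 0 < κ := by positivity
  have hκlt : κ < (a - b) / (2 * ν) := by
    rw [hκ, div_lt_div_iff₀ (by positivity) (by positivity)]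
    nlinarith
  refine isConst_of_driftOp_nonneg_of_eventually_skew (C := C * (N.factorial * Real.exp (1 + 1 / (4 * κ))))
    hν hb hba hκlt hΘ hUc hsub hU hT (fun z => (hgrowth z).trans ?_) x y
  rw [mul_assoc]
  exact mul_le_mul_of_nonneg_left (one_add_pow_le_exp_mul_sq hκ0 N (norm_nonneg z)) hC

end Summit.NavierStokesRegularity.NavierStokesRegularity.Theorems.HalfSpaceWindowDoorCirculationCarryingRigiditySkewDrift

end
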